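/- LEAD seat `ym-line-cbag-p1` (prover-ym-line-cbag-p1-g24-0), route `EguchiKawaiDirectionLadder` (ideator ym-idea-2, LINE 8),
crux K_A `TripleSmallBallMargin` (stmt-QuantumFields-27724), S10-C CORE of the LEAD's v7 architecture: the ONE-LEVEL DECOUPLING of
the first-link fibre of the triple small-ball event.  For a diagonal first link `D = diag(d)` and a labelling `ℓ : Fin N → Fin (m+1)`
(collar = `Fin.last m`) with `γ`-separated labelled blocks, the Haar-pair measure of `{(X,Y) : S_R(D,X,Y) ≤ t}` is at most
`(∏_{labelled c} min{ρ_c², ψ_c}) · Haar(A)²`, where `A` is the off-block event (masses `≤ 2Nt/γ`), `ρ_c` the rank-robust RIGIDITY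
measure of block `c` and `ψ_c` the rank-robust PAIR measure of block `c` (rank slack `O(#collar)`, LINEAR Frobenius slack) — by width
seat w4's general decoupling inequality `haar_prod_le_prod_mul_of_blockPair_fibres` instantiated with the block-local event
RIG ∩ RIG ∩ COMM (w4's linear cross-term lemma, w4's compression split with operator-norm bound, LEAD's `blockPairFibre_le_min` and
`…SymFibreEvents`).  ROUTE-INDEPENDENT.  Nothing here bears on the Yang–Mills mass gap (barrier-ledger line onto `EguchiKawaiBreakdown`). -/
import Summits.QuantumFields.YangMills.Theorems.EguchiKawaiDirectionLadderSymFibreEvents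
import Summits.QuantumFields.YangMills.Theorems.EguchiKawaiDirectionLadderBlockPairFibre
import Summits.QuantumFields.YangMills.Theorems.EguchiKawaiDirectionLadderOffBlockEvent
import Summits.QuantumFields.YangMills.Theorems.EguchiKawaiDirectionLadderBlockPairCrossLinear
import Summits.QuantumFields.YangMills.Theorems.EguchiKawaiDirectionLadderCompressionSplitLabelsOpNorm
import HarnessLib

/-!
# Route `EguchiKawaiDirectionLadder`, crux `TripleSmallBallMargin`: the decoupled first-link fibre (S10-C core)

`symFibre_decoupled`: with `T = {c ≠ last}` the labelled blocks, `q = #{ℓ = last}` the collar size, `b = 2Nt/γ`: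
`Haar²{(X,Y) : S_R(D,X,Y) ≤ t} ≤ (∏_{c ∈ T} min{ρ_c·ρ_c, ψ_c}) · Haar(offBlockEvent ℓ b)²` where
`ρ_c = Haar_c{V′ : ∃R′, rank R′ ≤ 2q, Σ|(Λ_cV′ − V′Λ_c − R′)|² ≤ 4Nt + 8mb}` (`Λ_c = diag(d|_c)`) and
`ψ_c = Haar_c²{(P₁,P₂) : ∃L, rank L ≤ 6q, Σ|(P₁P₂ − P₂P₁ − L)|² ≤ 2(4Nt + 8m²b) + 72mb}`.
-/

set_option autoImplicit false

noncomputable section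

open MeasureTheory
open scoped Matrix ENNReal
open Literature.Barriers.QuantumFields

namespace Summit.QuantumFields.YangMills.Theorems.EguchiKawaiDirectionLadder

open Literature.MathematicalPhysics.QuantumFieldTheory (haarProbability)

variable {N m : ℕ}

/-- The labelled blocks: all labels but the collar label `Fin.last m`. -/
def labelledBlocks (m : ℕ) : Finset (Fin (m + 1)) := Finset.univ.filter fun c => c ≠ Fin.last m

/-- Membership in the labelled blocks. -/
theorem mem_labelledBlocks {c : Fin (m + 1)} : c ∈ labelledBlocks m ↔ c ≠ Fin.last m := by
  simp [labelledBlocks]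

/-- The triple small-ball event in the first-link fibre over `D`, as a pair event. -/
def tripleFibreEvent (D : UN N) (t : ℝ) : Set (UN N × UN N) :=
  {P : UN N × UN N | ekAction (![D, P.1, P.2] : EKConfig 3 N) ≤ t}

/-- The fibre event is measurable (closed). -/
theorem measurableSet_tripleFibreEvent (D : UN N) (t : ℝ) : MeasurableSet (tripleFibreEvent D t) := by
  refine (isClosed_le ?_ continuous_const).measurableSet
  refine continuous_ekAction.comp (continuous_pi fun i => ?_)
  fin_cases i
  · simpa using continuous_const
  · simpa using continuous_fst
  · simpa using continuous_snd

/-- The within-block rigidity-and-commutator event of block `c` (block-local: depends on `X, Y` and the block pair only). -/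
def blockLocalEvent (ℓ : Fin N → Fin (m + 1)) (d : Fin N → ℂ) (X Y : UN N) (c : Fin (m + 1)) (s₁ σ : ℝ) (k : ℕ) :
    Set (Matrix.unitaryGroup {i : Fin N // ℓ i = c} ℂ × Matrix.unitaryGroup {i : Fin N // ℓ i = c} ℂ) :=
  {V | ∑ i : {i : Fin N // ℓ i = c}, ∑ j : {j : Fin N // ℓ j = c}, ‖d i.1 - d j.1‖ ^ 2 *
        ‖((X : Matrix (Fin N) (Fin N) ℂ).toBlock (fun i => ℓ i = c) (fun i => ℓ i = c) *
          (V.1 : Matrix {i : Fin N // ℓ i = c} {i : Fin N // ℓ i = c} ℂ)) i j‖ ^ 2 ≤ s₁ ∧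
      ∑ i : {i : Fin N // ℓ i = c}, ∑ j : {j : Fin N // ℓ j = c}, ‖d i.1 - d j.1‖ ^ 2 *
        ‖((Y : Matrix (Fin N) (Fin N) ℂ).toBlock (fun i => ℓ i = c) (fun i => ℓ i = c) *
          (V.2 : Matrix {i : Fin N // ℓ i = c} {i : Fin N // ℓ i = c} ℂ)) i j‖ ^ 2 ≤ s₁ ∧
      ∃ L : Matrix {i : Fin N // ℓ i = c} {i : Fin N // ℓ i = c} ℂ, L.rank ≤ k ∧
        ∑ i, ∑ j, ‖((X : Matrix (Fin N) (Fin N) ℂ).toBlock (fun i => ℓ i = c) (fun i => ℓ i = c) *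
              (V.1 : Matrix {i : Fin N // ℓ i = c} {i : Fin N // ℓ i = c} ℂ) *
            ((Y : Matrix (Fin N) (Fin N) ℂ).toBlock (fun i => ℓ i = c) (fun i => ℓ i = c) *
              (V.2 : Matrix {i : Fin N // ℓ i = c} {i : Fin N // ℓ i = c} ℂ)) -
          (Y : Matrix (Fin N) (Fin N) ℂ).toBlock (fun i => ℓ i = c) (fun i => ℓ i = c) *
              (V.2 : Matrix {i : Fin N // ℓ i = c} {i : Fin N // ℓ i = c} ℂ) *
            ((X : Matrix (Fin N) (Fin N) ℂ).toBlock (fun i => ℓ i = c) (fun i => ℓ i = c) *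
              (V.1 : Matrix {i : Fin N // ℓ i = c} {i : Fin N // ℓ i = c} ℂ)) - L) i j‖ ^ 2 ≤ σ}

/-- The rank-robust rigidity measure of block `c` at budget `β` and rank slack `r` (phases `d` restricted to the block). -/
def blockRigidityMeasure (ℓ : Fin N → Fin (m + 1)) (d : Fin N → ℂ) (c : Fin (m + 1)) (β : ℝ) (r : ℕ) : ℝ≥0∞ :=
  haarProbability (Matrix.unitaryGroup {i : Fin N // ℓ i = c} ℂ)
    {V' : Matrix.unitaryGroup {i : Fin N // ℓ i = c} ℂ | ∃ R' : Matrix {i : Fin N // ℓ i = c} {i : Fin N // ℓ i = c} ℂ,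
      R'.rank ≤ r ∧
      ∑ i, ∑ j, ‖(Matrix.diagonal (fun i : {i : Fin N // ℓ i = c} => d i.1) *
            (V' : Matrix {i : Fin N // ℓ i = c} {i : Fin N // ℓ i = c} ℂ) -
          (V' : Matrix {i : Fin N // ℓ i = c} {i : Fin N // ℓ i = c} ℂ) *
            Matrix.diagonal (fun i : {i : Fin N // ℓ i = c} => d i.1) - R') i j‖ ^ 2 ≤ β}

/-- The rank-robust pair measure of block `c` at budget `β` and rank slack `r`. -/
def blockPairMeasure (ℓ : Fin N → Fin (m + 1)) (c : Fin (m + 1)) (β : ℝ) (r : ℕ) : ℝ≥0∞ :=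
  (haarProbability (Matrix.unitaryGroup {i : Fin N // ℓ i = c} ℂ)).prod
    (haarProbability (Matrix.unitaryGroup {i : Fin N // ℓ i = c} ℂ))
    {P : Matrix.unitaryGroup {i : Fin N // ℓ i = c} ℂ × Matrix.unitaryGroup {i : Fin N // ℓ i = c} ℂ |
      ∃ L : Matrix {i : Fin N // ℓ i = c} {i : Fin N // ℓ i = c} ℂ, L.rank ≤ r ∧
        ∑ i, ∑ j, ‖((P.1 : Matrix {i : Fin N // ℓ i = c} {i : Fin N // ℓ i = c} ℂ) *
              (P.2 : Matrix {i : Fin N // ℓ i = c} {i : Fin N // ℓ i = c} ℂ) -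
            (P.2 : Matrix {i : Fin N // ℓ i = c} {i : Fin N // ℓ i = c} ℂ) *
              (P.1 : Matrix {i : Fin N // ℓ i = c} {i : Fin N // ℓ i = c} ℂ) - L) i j‖ ^ 2 ≤ β}

/-- The far labels of block `c`: labelled blocks other than `c`. -/
theorem card_far_le (c : Fin (m + 1)) :
    ((Finset.univ.erase c).filter (fun a => a ∉ ({Fin.last m} : Finset (Fin (m + 1))))).card ≤ m := by
  classical
  by_cases hc : c = Fin.last m
  · calc _ ≤ (Finset.univ.erase c).card := Finset.card_filter_le _ _
      _ = m := by rw [Finset.card_erase_of_mem (Finset.mem_univ _), Finset.card_univ, Fintype.card_fin]; omega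
  · calc _ ≤ ((Finset.univ : Finset (Fin (m + 1))).erase (Fin.last m)).card := by
          refine Finset.card_le_card ?_
          intro a ha
          simp only [Finset.mem_filter, Finset.mem_erase, Finset.mem_univ, and_true, Finset.mem_singleton] at ha ⊢
          exact ha.2
      _ = m := by rw [Finset.card_erase_of_mem (Finset.mem_univ _), Finset.card_univ, Fintype.card_fin]; omega

/-- On the off-block event, the far mass of block `c` is `≤ m·b`. -/
theorem far_mass_le (ℓ : Fin N → Fin (m + 1)) {b : ℝ} (hb : 0 ≤ b) {X : UN N} (hX : X ∈ offBlockEvent ℓ b)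
    (c : Fin (m + 1)) (hc : c ≠ Fin.last m) :
    ∑ a ∈ (Finset.univ.erase c).filter (fun a => a ∉ ({Fin.last m} : Finset (Fin (m + 1)))),
      ∑ i, ∑ j, ‖(X : Matrix (Fin N) (Fin N) ℂ).toBlock (fun i => ℓ i = c) (fun i => ℓ i = a) i j‖ ^ 2 ≤ m * b := by
  classical
  have hterm : ∀ a ∈ (Finset.univ.erase c).filter (fun a => a ∉ ({Fin.last m} : Finset (Fin (m + 1)))),
      ∑ i, ∑ j, ‖(X : Matrix (Fin N) (Fin N) ℂ).toBlock (fun i => ℓ i = c) (fun i => ℓ i = a) i j‖ ^ 2 ≤ b := by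
    intro a ha
    simp only [Finset.mem_filter, Finset.mem_erase, Finset.mem_univ, and_true, Finset.mem_singleton] at ha
    obtain ⟨hac, hal⟩ := ha
    set c₀ := c.castPred hc with hc₀
    set a₀ := a.castPred hal with ha₀
    have hcc : c = c₀.castSucc := by rw [hc₀, Fin.castSucc_castPred]
    have haa : a = a₀.castSucc := by rw [ha₀, Fin.castSucc_castPred]
    have hne : c₀ ≠ a₀ := by
      intro h; apply hac; rw [hcc, haa, h]
    have h := hX c₀ a₀ hne
    rw [← hcc, ← haa] at h
    exact h
  calc _ ≤ ∑ a ∈ (Finset.univ.erase c).filter (fun a => a ∉ ({Fin.last m} : Finset (Fin (m + 1)))), b := Finset.sum_le_sum hterm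
    _ = _ * b := by rw [Finset.sum_const, nsmul_eq_mul]
    _ ≤ m * b := by
        refine mul_le_mul_of_nonneg_right ?_ hb
        exact_mod_cast card_far_le c

/-- **THE DECOUPLED FIBRE (S10-C core).**  See the module docstring. -/
theorem symFibre_decoupled (hN : 0 < N) (ℓ : Fin N → Fin (m + 1)) (D : UN N) (d : Fin N → ℂ)
    (hD : (D : Matrix (Fin N) (Fin N) ℂ) = Matrix.diagonal d) (hd : ∀ i, ‖d i‖ = 1) {γ : ℝ} (hγ : 0 < γ)
    (hsep : ∀ i j, ℓ i ≠ ℓ j → ℓ i ≠ Fin.last m → ℓ j ≠ Fin.last m → γ ≤ ‖d i - d j‖ ^ 2) {t : ℝ} (ht : 0 < t) :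
    (haarProbability (UN N)).prod (haarProbability (UN N)) (tripleFibreEvent D t) ≤
      (∏ c ∈ labelledBlocks m,
          min (blockRigidityMeasure ℓ d c (2 * (2 * N * t) + 8 * (m * (2 * N * t / γ)))
                  (2 * Fintype.card {i : Fin N // ℓ i = Fin.last m}) *
               blockRigidityMeasure ℓ d c (2 * (2 * N * t) + 8 * (m * (2 * N * t / γ)))
                  (2 * Fintype.card {i : Fin N // ℓ i = Fin.last m}))
            (blockPairMeasure ℓ c
              (2 * (4 * N * t + 8 * m * m * (2 * N * t / γ)) + 36 * (m * (2 * N * t / γ) + m * (2 * N * t / γ)))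
              (2 * Fintype.card {i : Fin N // ℓ i = Fin.last m} +
                2 * (Fintype.card {i : Fin N // ℓ i = Fin.last m} + Fintype.card {i : Fin N // ℓ i = Fin.last m})))) *
        (haarProbability (UN N)).prod (haarProbability (UN N))
          (offBlockEvent ℓ (2 * N * t / γ) ×ˢ offBlockEvent ℓ (2 * N * t / γ)) := by
  classical
  set b : ℝ := 2 * N * t / γ with hb
  have hb0 : 0 ≤ b := by positivity
  set q : ℕ := Fintype.card {i : Fin N // ℓ i = Fin.last m} with hq
  set T := labelledBlocks m with hT
  have hqsum : ∑ a ∈ ({Fin.last m} : Finset (Fin (m + 1))), Fintype.card {i : Fin N // ℓ i = a} = q := by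
    rw [Finset.sum_singleton]
  -- block unitaries from `W` restricted to `T`
  refine haar_prod_le_prod_mul_of_blockPair_fibres ℓ T (measurableSet_tripleFibreEvent D t)
    (offBlockEvent ℓ b) (offBlockEvent ℓ b)
    (fun c X Y => blockLocalEvent ℓ d X Y c (2 * N * t) (4 * N * t + 8 * m * m * b) (2 * q))
    _ ?_ ?_
  · -- h1: consequences of the triple event
    intro X Y W hW
    set V := fstOn T W with hV
    set V' := sndOn T W with hV'
    have hE : ekAction (![D, X * blockDiagUnitary ℓ V, Y * blockDiagUnitary ℓ V'] : EKConfig 3 N) ≤ t := hW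
    obtain ⟨hDX, hDY, hXY⟩ := pair_frobSq_le_of_ekAction_three_le hN D (X * blockDiagUnitary ℓ V) (Y * blockDiagUnitary ℓ V') hE
    rw [hD] at hDX hDY
    -- off-block membership
    have hoff : ∀ (Z : UN N) (U : BlockUnitaries ℓ),
        frobSq (Matrix.diagonal d * ((Z * blockDiagUnitary ℓ U : UN N) : Matrix (Fin N) (Fin N) ℂ) -
          ((Z * blockDiagUnitary ℓ U : UN N) : Matrix (Fin N) (Fin N) ℂ) * Matrix.diagonal d) ≤ 2 * N * t →
        Z ∈ offBlockEvent ℓ b := by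
      intro Z U hZ a a' haa
      rw [← offBlock_mass_mul_blockDiag ℓ Z U (fun i => ℓ i = a.castSucc) a'.castSucc]
      have hsep' : ∀ i j, ℓ i = a.castSucc → ℓ j = a'.castSucc → γ ≤ ‖d i - d j‖ ^ 2 := by
        intro i j hi hj
        refine hsep i j ?_ ?_ ?_
        · rw [hi, hj]; exact fun h => haa (Fin.castSucc_injective _ h)
        · rw [hi]; exact (Fin.castSucc_lt_last a).ne
        · rw [hj]; exact (Fin.castSucc_lt_last a').ne
      have h := offBlock_mass_le d ((Z * blockDiagUnitary ℓ U : UN N) : Matrix (Fin N) (Fin N) ℂ)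
        (fun i => ℓ i = a.castSucc) (fun j => ℓ j = a'.castSucc) hsep'
      rw [hb, le_div_iff₀ hγ, mul_comm]
      exact h.trans hZ
    have hXA : X ∈ offBlockEvent ℓ b := hoff X V hDX
    have hYA : Y ∈ offBlockEvent ℓ b := hoff Y V' hDY
    refine ⟨hXA, hYA, fun c hc => ?_⟩
    have hcT : c ≠ Fin.last m := mem_labelledBlocks.1 hc
    have hVc : V c = (W c).1 := fstOn_of_mem W hc
    have hV'c : V' c = (W c).2 := sndOn_of_mem W hc
    refine ⟨?_, ?_, ?_⟩
    · have h := withinBlock_rigidity_le ℓ d X V c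
      rw [hVc] at h
      exact h.trans hDX
    · have h := withinBlock_rigidity_le ℓ d Y V' c
      rw [hV'c] at h
      exact h.trans hDY
    · -- commutator block: w4's linear cross-term absorption
      have h := commutatorBlock_le ((X * blockDiagUnitary ℓ V : UN N) : Matrix (Fin N) (Fin N) ℂ)
        ((Y * blockDiagUnitary ℓ V' : UN N) : Matrix (Fin N) (Fin N) ℂ) (fun i => ℓ i = c)
      simp only [Matrix.UnitaryGroup.mul_val, coe_blockDiagUnitary] at h hXY
      have hs := h.trans hXY
      obtain ⟨J', hJ', hcomm⟩ := blockLocal_robustPair_of_commutatorBlock_small_linear ℓ X Y V V' c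
        ({Fin.last m} : Finset (Fin (m + 1))) hs
      rw [hqsum] at hJ'
      refine ⟨J', hJ', ?_⟩
      have hwp : withinPair ℓ (X : Matrix (Fin N) (Fin N) ℂ) (Y : Matrix (Fin N) (Fin N) ℂ) V V' c =
          (X : Matrix (Fin N) (Fin N) ℂ).toBlock (fun i => ℓ i = c) (fun i => ℓ i = c) *
              ((W c).1 : Matrix {i : Fin N // ℓ i = c} {i : Fin N // ℓ i = c} ℂ) *
            ((Y : Matrix (Fin N) (Fin N) ℂ).toBlock (fun i => ℓ i = c) (fun i => ℓ i = c) *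
              ((W c).2 : Matrix {i : Fin N // ℓ i = c} {i : Fin N // ℓ i = c} ℂ)) -
          (Y : Matrix (Fin N) (Fin N) ℂ).toBlock (fun i => ℓ i = c) (fun i => ℓ i = c) *
              ((W c).2 : Matrix {i : Fin N // ℓ i = c} {i : Fin N // ℓ i = c} ℂ) *
            ((X : Matrix (Fin N) (Fin N) ℂ).toBlock (fun i => ℓ i = c) (fun i => ℓ i = c) *
              ((W c).1 : Matrix {i : Fin N // ℓ i = c} {i : Fin N // ℓ i = c} ℂ)) := by
        unfold withinPair crossTerm; rw [hVc, hV'c]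
      rw [hwp] at hcomm
      refine hcomm.trans ?_
      -- far masses ≤ m·b each
      have hfX := far_mass_le ℓ hb0 hXA c hcT
      have hfY := far_mass_le ℓ hb0 hYA c hcT
      have hcard : (((Finset.univ.erase c).filter (fun a => a ∉ ({Fin.last m} : Finset (Fin (m + 1))))).card : ℝ) ≤ m := by
        exact_mod_cast card_far_le c
      rw [Finset.sum_add_distrib]
      set SX := ∑ a ∈ (Finset.univ.erase c).filter (fun a => a ∉ ({Fin.last m} : Finset (Fin (m + 1)))),
        ∑ i, ∑ j, ‖(X : Matrix (Fin N) (Fin N) ℂ).toBlock (fun i => ℓ i = c) (fun i => ℓ i = a) i j‖ ^ 2 with hSX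
      set SY := ∑ a ∈ (Finset.univ.erase c).filter (fun a => a ∉ ({Fin.last m} : Finset (Fin (m + 1)))),
        ∑ i, ∑ j, ‖(Y : Matrix (Fin N) (Fin N) ℂ).toBlock (fun i => ℓ i = c) (fun i => ℓ i = a) i j‖ ^ 2 with hSY
      have hSX0 : 0 ≤ SX := Finset.sum_nonneg fun a _ => Finset.sum_nonneg fun i _ => Finset.sum_nonneg fun j _ => by positivity
      have hSY0 : 0 ≤ SY := Finset.sum_nonneg fun a _ => Finset.sum_nonneg fun i _ => Finset.sum_nonneg fun j _ => by positivity
      have hm0 : (0 : ℝ) ≤ m := Nat.cast_nonneg m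
      have hNt : (0 : ℝ) ≤ N * t := by positivity
      have hprod := mul_le_mul hcard (add_le_add hfX hfY) (add_nonneg hSX0 hSY0) hm0
      nlinarith [hprod]
  · -- h2: compression split + block-local fibre bound
    intro X hXA Y hYA c hc
    have hcT : c ≠ Fin.last m := mem_labelledBlocks.1 hc
    obtain ⟨Θ₁, R₁, S₁, hΘ₁, hR₁, hS₁, hS₁', hX⟩ := compression_split_labels_opNorm ℓ X c ({Fin.last m} : Finset (Fin (m + 1)))
    obtain ⟨Θ₂, R₂, S₂, hΘ₂, hR₂, hS₂, hS₂', hY⟩ := compression_split_labels_opNorm ℓ Y c ({Fin.last m} : Finset (Fin (m + 1)))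
    rw [hqsum] at hR₁ hR₂
    have he₁ : ∑ i, ∑ j, ‖S₁ i j‖ ^ 2 ≤ m * b := hS₁.trans (far_mass_le ℓ hb0 hXA c hcT)
    have he₂ : ∑ i, ∑ j, ‖S₂ i j‖ ^ 2 ≤ m * b := hS₂.trans (far_mass_le ℓ hb0 hYA c hcT)
    have hd' : ∀ i : {i : Fin N // ℓ i = c}, ‖(fun i : {i : Fin N // ℓ i = c} => d i.1) i‖ ≤ 1 := fun i => (hd i.1).le
    have hmain := blockPairFibre_le_min (α := {i : Fin N // ℓ i = c}) ⟨Θ₁, hΘ₁⟩ ⟨Θ₂, hΘ₂⟩ R₁ S₁ R₂ S₂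
      (fun i : {i : Fin N // ℓ i = c} => d i.1) hd' (s₁ := 2 * N * t) (s := 4 * N * t + 8 * m * m * b) (k := 2 * q)
      hR₁ hR₂ he₁ he₂ hS₁' hS₂'
    have hset : blockLocalEvent ℓ d X Y c (2 * N * t) (4 * N * t + 8 * m * m * b) (2 * q) =
        {V : Matrix.unitaryGroup {i : Fin N // ℓ i = c} ℂ × Matrix.unitaryGroup {i : Fin N // ℓ i = c} ℂ |
          ∑ i, ∑ j, ‖(fun i : {i : Fin N // ℓ i = c} => d i.1) i - (fun i : {i : Fin N // ℓ i = c} => d i.1) j‖ ^ 2 *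
              ‖((Θ₁ + R₁ + S₁) * (V.1 : Matrix {i : Fin N // ℓ i = c} {i : Fin N // ℓ i = c} ℂ)) i j‖ ^ 2 ≤ 2 * N * t ∧
          ∑ i, ∑ j, ‖(fun i : {i : Fin N // ℓ i = c} => d i.1) i - (fun i : {i : Fin N // ℓ i = c} => d i.1) j‖ ^ 2 *
              ‖((Θ₂ + R₂ + S₂) * (V.2 : Matrix {i : Fin N // ℓ i = c} {i : Fin N // ℓ i = c} ℂ)) i j‖ ^ 2 ≤ 2 * N * t ∧
          ∃ L : Matrix {i : Fin N // ℓ i = c} {i : Fin N // ℓ i = c} ℂ, L.rank ≤ 2 * q ∧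
            ∑ i, ∑ j, ‖((Θ₁ + R₁ + S₁) * (V.1 : Matrix {i : Fin N // ℓ i = c} {i : Fin N // ℓ i = c} ℂ) *
                ((Θ₂ + R₂ + S₂) * (V.2 : Matrix {i : Fin N // ℓ i = c} {i : Fin N // ℓ i = c} ℂ)) -
              (Θ₂ + R₂ + S₂) * (V.2 : Matrix {i : Fin N // ℓ i = c} {i : Fin N // ℓ i = c} ℂ) *
                ((Θ₁ + R₁ + S₁) * (V.1 : Matrix {i : Fin N // ℓ i = c} {i : Fin N // ℓ i = c} ℂ)) - L) i j‖ ^ 2 ≤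
              4 * N * t + 8 * m * m * b} := by
      simp only [blockLocalEvent, ← hX, ← hY]
    rw [hset]
    exact hmain

end Summit.QuantumFields.YangMills.Theorems.EguchiKawaiDirectionLadder

end
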